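import Literature.NumberTheory.EllipticCurves.HeegnerPointsOfConductor
import HarnessLib

/-!
# (P0′) of RULING 46 — the GENERALISED Kolyvagin datum `KolyvaginFamilyData W K ι n`: Kolyvagin's level-`n` data
# (point over the ring class field, generators `σ_ℓ`, transversal `S`, embedding `K[n] → K̄`) WITHOUT the `X₀(N)`-specific
# fields of `KolyvaginHeegnerData` (`map_y` : the point is `φ(x_n)`; `dvd_sq_sub` : the orientation `β² ≡ d_K (4N)`), and the
# forgetful map `KolyvaginHeegnerData.toFamilyData` (cell `bsd-stepL`, seat `bsd-stepL-tam3-p1` g12, owner of 19109's line;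
# `--supports stmt-BirchSwinnertonDyer-19109 --as helper`)

WHY (plan g38 RULING 46, adopting this seat's PORT MAP (P0′) «generalise the datum, additively and on demand»). The Jetchev
walk of 19109's line (`…EulerHalvesAtThreeWalk*`, cell bsd-jet's road K `Rank1ResidualJet*`) is typed on
`KolyvaginHeegnerData Dt β ι n`, which is UNINHABITED on the Shimura frames of the inert road (`dvd_sq_sub` fails when
`3, ℓ₀ ∈ S` are inert in `K`); of the 82 on-path files binding it, ≈ 60 use the datum only as a carrier of
`(y, σ, S, emb)` and of the derived objects `derivedPoint`, `toGeomPoints`, `pointsSubgroup`, `kolyvaginClass`. This module is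
the FIRST FILE of the ruling: the carrier structure and the same derived objects, with `rfl` dictionary lemmas along
`toFamilyData`, so that a carrier-only walk file re-keys by the substitution
`(d : KolyvaginHeegnerData Dt β ι n) ↦ (d : KolyvaginFamilyData W K ι n)` and its `X₀(N)` instance is recovered by
`d.toFamilyData`; the ≈ 20 `X₀(N)`-specific files are NOT generalised (their facts enter the Shimura walk as the labels
(B2)–(B6), cf. `ShimuraKolyvaginOfImage.receptacle_of_labelB6`, p591819). A labelled CM family on `X_{N⁺,N⁻}`
(`ys m ∈ E(K[m])` + corner3-p2 g5's `exists_ringClassLevelData` choices of `σ`, `S`, `emb`) populates the structure directly.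

HONEST FRAMING: ONE structure, FOUR derived definitions (VERBATIM twins of the `KolyvaginHeegnerData` ones), ONE forgetful
map and `rfl` lemmas (the two `KolyvaginHeegnerData` convenience lemmas `kolyvaginClass_of_admissible` ∕ `_ne_zero` are NOT
restated — dedup lint; `kolyvaginClass_def` unfolds the `dite`); no named fact, no instance, no notation, no `sorry`; nothing about any curve is asserted; no item closes;
BSD is not proved by any of this. Nothing landed is edited (additive file).
References: [cite: GrossLMS1991, §3–§4, (4.1), (4.4), (4.6)] [cite: WZhang2014, §3.7, (3.21), (3.22)]
[cite: McCallumLMS1991, §4 (4.6)] [cite: BertoliniDarmon1996, §2.3–2.5] [cite: Jetchev2008, §3.1, Def. 4.8].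
presearch: not applicable (interface twin of a tree structure); `lean search 'KolyvaginFamilyData|toFamilyData'` → none.
-/

set_option autoImplicit false

noncomputable section

open scoped Classical

universe u

namespace Summit.BirchSwinnertonDyer.Rank1Residual.JET

open WeierstrassCurve NumberField Literature.NumberTheory.EllipticCurves
  Literature.NumberTheory.EllipticCurves.KolyvaginCocycle

/-- **Kolyvagin's level-`n` data for an ARBITRARY family of points over the ring class fields** (Gross 1991 §§3–4 ∕
W. Zhang 2014 §3.7 ∕ Bertolini–Darmon 1996 §2.3–2.5, with no reference to a modular or Shimura parametrisation):
the point `y ∈ E(K[n])`, fixed generators `σ_ℓ` of `Gal(K[n]/K[n/ℓ])` for the primes `ℓ ∣ n`, a transversal `S` of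
`Gal(K[n]/K[1])` in `Gal(K[n]/K)`, and a `K`-embedding `K[n] → K̄`. = `KolyvaginHeegnerData Dt β ι n` with its two
`X₀(N)`-specific fields (`dvd_sq_sub`, `map_y`) removed; see `KolyvaginHeegnerData.toFamilyData`.
[cite: GrossLMS1991, §3–§4 (4.1)] [cite: WZhang2014, §3.7] [cite: BertoliniDarmon1996, §2.3–2.5] -/
structure KolyvaginFamilyData (W : WeierstrassCurve ℚ) (K : Type u) [Field K] [NumberField K] (ι : K →+* ℂ)
    (n : ℕ) where
  /-- The point `y(n) ∈ E(K[n])`. -/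
  y : (W.baseChange (ringClassField K ι n)).toAffine.Point
  /-- The generators `σ_ℓ` (values off the prime factors of `n` are irrelevant). -/
  σ : ℕ → (ringClassField K ι n ≃ₐ[ℚ] ringClassField K ι n)
  /-- `σ_ℓ` generates `G_ℓ = Gal(K[n]/K[n/ℓ])` for every prime `ℓ ∣ n`. -/
  zpowers_σ : ∀ ℓ ∈ n.primeFactors, Subgroup.zpowers (σ ℓ) = ringClassGalOver ι n (n / ℓ)
  /-- The coset representatives `S ⊆ 𝒢_n`. -/
  S : Finset (ringClassField K ι n ≃ₐ[ℚ] ringClassField K ι n)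
  /-- `S ⊆ 𝒢_n = Gal(K[n]/K)`. -/
  S_subset : ∀ s ∈ S, s ∈ ringClassGal ι n
  /-- `S` is a system of representatives of `𝒢_n / G_n`. -/
  S_transversal : ∀ g ∈ ringClassGal ι n, ∃! s, s ∈ S ∧ g⁻¹ * s ∈ ringClassGalOver ι n 1
  /-- An embedding `K[n] → K̄`. -/
  emb : ringClassField K ι n →+* AlgebraicClosure K
  /-- `emb` is the identity on `K`. -/
  emb_apply : ∀ k : K, emb (algebraMap K (ringClassField K ι n) k) =
    algebraMap K (AlgebraicClosure K) k

namespace KolyvaginFamilyData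

variable {W : WeierstrassCurve ℚ} {K : Type u} [Field K] [NumberField K] {ι : K →+* ℂ} {n : ℕ}
  (d : KolyvaginFamilyData W K ι n)

/-- **The derived point `P(n) = Σ_{σ ∈ S} σ(D_n y(n)) ∈ E(K[n])`** (Gross 1991 (4.1); W. Zhang 2014 §3.7), VERBATIM the
`KolyvaginHeegnerData` definition. [cite: GrossLMS1991, §4 (4.1)] [cite: WZhang2014, §3.7 (P(n))] -/
def derivedPoint : (W.baseChange (ringClassField K ι n)).toAffine.Point :=
  KolyvaginOperator.derivedPoint (pointGalHom W (ringClassField K ι n)) d.σ n d.S d.y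

/-- At `n = 1`: `P(1) = Σ_{σ ∈ S} σ y(1) = Tr_{K[1]/K} y(1)`. [cite: GrossLMS1991, §4 (P_1 = y_K)] -/
theorem derivedPoint_one (d₁ : KolyvaginFamilyData W K ι 1) :
    d₁.derivedPoint = ∑ s ∈ d₁.S, pointGalHom W (ringClassField K ι 1) s d₁.y :=
  KolyvaginOperator.derivedPoint_one _ _ _ _

/-- `E(K[n]) → E(K̄)` along the embedding `K[n] → K̄`. [folklore] -/
def toGeomPoints : (W.baseChange (ringClassField K ι n)).toAffine.Point →+ geomPoints (W.baseChange K) :=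
  WeierstrassCurve.Affine.Point.map (W' := W) d.emb.toRatAlgHom

/-- **`E(K[n]) ⊆ E(K̄)`**, the subgroup `A` of McCallum's cocycle: the image of `toGeomPoints`.
[cite: GrossLMS1991, §4 (4.2)–(4.4)] -/
def pointsSubgroup : AddSubgroup (geomPoints (W.baseChange K)) :=
  d.toGeomPoints.range

/-- **Kolyvagin's class `c_M(n) ∈ H¹(K, E[p^M])`** (Gross 1991 (4.4), McCallum's cocycle (4.6); W. Zhang 2014 (3.21)),
VERBATIM the `KolyvaginHeegnerData` definition (junk value `0` off admissibility ∕ invariance).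
[cite: GrossLMS1991, §4 (4.4), (4.6)] [cite: WZhang2014, §3.7 (3.21)] -/
def kolyvaginClass {p : ℕ} (hp : p.Prime) (M : ℕ) :
    galH1Torsion (W.baseChange K) ((p ^ M : ℕ) : ℤ) :=
  if h : KolyvaginCocycle.IsAdmissible (Field.absoluteGaloisGroup K) d.pointsSubgroup
        ((p ^ M : ℕ) : ℤ) ∧
      d.toGeomPoints d.derivedPoint ∈
        KolyvaginCocycle.invPoints (Field.absoluteGaloisGroup K) d.pointsSubgroup ((p ^ M : ℕ) : ℤ)
  then
    _root_.Literature.NumberTheory.EllipticCurves.kolyvaginClass (W.baseChange K) ((p ^ M : ℕ) : ℤ)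
      ((W.baseChange K).zsmul_geomPoints_surjective_of_charZero
        (by exact_mod_cast pow_ne_zero M hp.ne_zero))
      h.1 (d.toGeomPoints d.derivedPoint) h.2
  else 0

/-- The definition of `c_M(n)` unfolded (the `dite` on admissibility ∧ invariance); use with `dif_pos` ∕ `dif_neg` — the
`KolyvaginHeegnerData` lemmas `kolyvaginClass_of_admissible` ∕ `kolyvaginClass_ne_zero` follow verbatim from it.
[cite: GrossLMS1991, §4 (4.4), (4.6)] -/
theorem kolyvaginClass_def {p : ℕ} (hp : p.Prime) (M : ℕ) :
    d.kolyvaginClass hp M =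
      if h : KolyvaginCocycle.IsAdmissible (Field.absoluteGaloisGroup K) d.pointsSubgroup
            ((p ^ M : ℕ) : ℤ) ∧
          d.toGeomPoints d.derivedPoint ∈
            KolyvaginCocycle.invPoints (Field.absoluteGaloisGroup K) d.pointsSubgroup ((p ^ M : ℕ) : ℤ)
      then
        _root_.Literature.NumberTheory.EllipticCurves.kolyvaginClass (W.baseChange K) ((p ^ M : ℕ) : ℤ)
          ((W.baseChange K).zsmul_geomPoints_surjective_of_charZero
            (by exact_mod_cast pow_ne_zero M hp.ne_zero))
          h.1 (d.toGeomPoints d.derivedPoint) h.2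
      else 0 := rfl

end KolyvaginFamilyData

/-! ### The forgetful map from the `X₀(N)` datum and its `rfl` dictionary -/

namespace KolyvaginHeegnerDataToFamily

variable {N : ℕ} [NeZero N] {W : WeierstrassCurve ℚ} {K : Type u} [Field K] [NumberField K]
  {Dt : ModularForms.ModularParametrizationData W N} {β : ℤ} {ι : K →+* ℂ} {n : ℕ}

/-- **Forget the `X₀(N)` parametrisation**: a Kolyvagin–Heegner datum is a family datum (drop `dvd_sq_sub`, `map_y`).
[cite: GrossLMS1991, §3–§4] -/
def _root_.Literature.NumberTheory.EllipticCurves.KolyvaginHeegnerData.toFamilyData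
    (d : KolyvaginHeegnerData Dt β ι n) : KolyvaginFamilyData W K ι n where
  y := d.y
  σ := d.σ
  zpowers_σ := d.zpowers_σ
  S := d.S
  S_subset := d.S_subset
  S_transversal := d.S_transversal
  emb := d.emb
  emb_apply := d.emb_apply

variable (d : KolyvaginHeegnerData Dt β ι n)

/-- Dictionary: the point. [folklore] -/
@[simp] theorem toFamilyData_y : d.toFamilyData.y = d.y := rfl

/-- Dictionary: the generators. [folklore] -/
@[simp] theorem toFamilyData_σ : d.toFamilyData.σ = d.σ := rfl

/-- Dictionary: the transversal. [folklore] -/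
@[simp] theorem toFamilyData_S : d.toFamilyData.S = d.S := rfl

/-- Dictionary: the embedding. [folklore] -/
@[simp] theorem toFamilyData_emb : d.toFamilyData.emb = d.emb := rfl

/-- Dictionary: the derived point `P(n)`. [cite: GrossLMS1991, §4 (4.1)] -/
@[simp] theorem toFamilyData_derivedPoint : d.toFamilyData.derivedPoint = d.derivedPoint := rfl

/-- Dictionary: `E(K[n]) → E(K̄)`. [folklore] -/
@[simp] theorem toFamilyData_toGeomPoints : d.toFamilyData.toGeomPoints = d.toGeomPoints := rfl

/-- Dictionary: the subgroup `E(K[n]) ⊆ E(K̄)`. [folklore] -/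
@[simp] theorem toFamilyData_pointsSubgroup : d.toFamilyData.pointsSubgroup = d.pointsSubgroup := rfl

/-- Dictionary: Kolyvagin's class `c_M(n)`. [cite: GrossLMS1991, §4 (4.4)] -/
@[simp] theorem toFamilyData_kolyvaginClass {p : ℕ} (hp : p.Prime) (M : ℕ) :
    d.toFamilyData.kolyvaginClass hp M = d.kolyvaginClass hp M := rfl

end KolyvaginHeegnerDataToFamily

end Summit.BirchSwinnertonDyer.Rank1Residual.JET

end
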